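import Summits.QuantumFields.YangMills.Theorems.BalabanUVNodesN15CovariantSandwichObjects
import HarnessLib

/-!
# N15 = NE2 — PROGRAMME 𝟙P «ONE PROPAGATOR», part (𝟙P-a): THE SITE∕UNIT MIDDLE FACTOR FOR ANY LIVE PROPAGATOR — `zAnyC X D E := unitBondMatC((Q⊗1 + D)∘X∘(Q*⊗1 + E) − (Q⊗1)(G⊗1)(Q*⊗1))`
# (the honest form AS the definition), its splitting, its dictionary with (Q-2a)'s `zCovC` at dag-n15-c's FILE 133 propagator, the increment identity of a right inverse, and three scalar budgets
# (dag-n15-a g32, FILE (𝟙P-a); node N15 = NE2; `--supports stmt-QuantumFields-27366 --as helper`, count-neutral; 2 plumbing defs + theorems; imports (Q-2a))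

WHY.  [B9] Thm 3.2 (3.48) p.398 and Thm 3.15 (3.187) p.432 read the SAME propagator `G(U)` as Thm 3.1 (3.42) («Under the assumptions of Theorem 3.1, and with the same constants …»).  The lane's
road-(c) literal `SiteLayerSf.sfObjects₅qv` (g31, (Q-7) v1.1∕v1.2) has its OPERATOR layer at dag-n15-c's glued propagator WITH the covariant averaging summand live (189a `sfqEntry0`:
`X_q := cvGlued … (P := cvNL − cvNVq(e^{ηĀ′})) (NV := cvNVq(e^{ηĀ′}))`), while its SITE and UNIT layers ((Q-3) `foSiteCov`, (Q-4) `foCovCovLam`) sandwich FILE 133's propagator with the summand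
FLAT (`(P := cvNL) (NV := 0)`, hard-wired in (Q-2a) `zCovC`): two model propagators in one literal (LOCATED-X, this seat, bus 2026-08-29 16:55Z).  PROGRAMME 𝟙P makes the site∕unit middle factor,
its three letters, both layers and the all-layers knit GENERIC in the inner propagator `X` — rows displayed on the INCREMENT `X − G⊗1` — so that ONE propagator is read by all three layers;
the instance at `X_q` is (𝟙P-e)∕(𝟙P-f), and dag-n15-c's (P-R) Landau-live propagator enters the same socket when it lands.

WHAT.  §1 defs `zAnyC X D E` (coarse), `zAnyF X′ D′ E′` (fine) for ARBITRARY linear maps `X, X′` on the cover's coloured 1-forms — the HONEST form as the definition; ★ `zAnyC_split` ∕ `zAnyF_split`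
(`= unitBondMatC((Q⊗1)(X − G⊗1)(Q*⊗1)) + unitBondMatC(D∘X∘(Q*⊗1 + E)) + unitBondMatC((Q⊗1)∘X∘E)`, (Q-2a) `covSandwich_sub_eq`); ★ `zCovC_eq_zAnyC` ∕ `zCovF_eq_zAnyF` (at FILE 133's propagator
`zAnyC` IS (Q-2a)'s `zCovC` — (Q-2a) `zCovC_eq`); `zAnyC_tensorId_gOp` (at `X = G⊗1`, `D = E = 0` it vanishes).  §2 ★ `sub_eq_comp_comp_of_comp_sub_eq_id`: a RIGHT INVERSE `X` of `T₀ − P` with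
`T₀∘G = 1` satisfies `X − G = X∘P∘G` — (I) §4 `sub_tensorId_gOp_eq_of_comp_eq_id` with the perturbation `P` abstract (at `X_q`: `P = speciesOpM(e^{ηĀ′}) + cvNVq(e^{ηĀ′})`, (𝟙P-e)).
§3 three scalar budgets for (𝟙P-b)'s letters (kept OUT of the operator context — g31 lesson: `linarith` there times out on atom comparison).

HONEST FRAMING ∕ LIMITS.  Definitions + linear algebra + scalar arithmetic; no estimate; the covariant averaging stays MODELLED as `Q⊗1 + D` with displayed rows ((Q-2a)); MODEL carriers of
dag-n15-c (two-spacing glued doubled torus, global small-field gauge `u ≡ 1`, `Q(U)` = main term of [5] (125), Landau summand flat until their (P-R), `Reg336` idle, `L ≥ 7`); no layer of NE2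
proved here; NOT [B9] Thms 3.1∕3.2∕3.15 AS PRINTED; N15 stays DISCHARGED OF RECORD 8∕28 AS CONSUMED (U-blind v7 pin, p687738) — no re-pin asked, nothing re-claimed, no count moved; K3⁸ OPEN;
finite 𝕋⁴ per index — NOT ℝ⁴ ∕ OS ∕ mass gap ∕ Clay.  Two plumbing `def`s ⇒ review ∕ audit lane.  `set_option maxRecDepth 8192 in` ×2 (one unfolding of (Q-2a)'s names, their declared budget).
No `sorry`, `instance`, `notation`; standard axioms.
[cite: Balaban1985BackgroundPropagators, Thm 3.1 (3.42) p.397, Thm 3.2 (3.48) p.398 («with the same constants»), Thm 3.15 (3.187) p.432, (3.78)–(3.81) p.406 (shape of the averaging perturbation); Balaban1984PropagatorsI,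
(1.18) p.20, (1.102)–(1.103) p.34 (the unit-lattice sandwich)]
-/

noncomputable section

open scoped BigOperators Matrix Matrix.Norms.Frobenius

namespace Summit.QuantumFields.YangMills.BalabanUVNodes.N15.GluedZeroField

open Literature.MathematicalPhysics.QuantumFieldTheory.Balaban1983to89
open Literature.MathematicalPhysics.QuantumFieldTheory.Balaban1983to89.B5Prop11Plancherel (Tor fine)
open Literature.MathematicalPhysics.QuantumFieldTheory.Balaban1983to89.B6Lemma24Torus (pbox)
open Literature.Barriers.QuantumFields (traceForm)
open Summit.QuantumFields.YangMills.BalabanUVNodes.N15.BackgroundLayer (gavgM tensorId_comp_tensorId)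
open Summit.QuantumFields.YangMills.BalabanUVNodes.N15.VectorPiece (bshiftEquiv kingPrV tensorId)
open Summit.QuantumFields.YangMills.BalabanUVNodes.N15.TwoGrid (gOp qvRe qvAdjRe)
open Summit.QuantumFields.YangMills.BalabanUVNodes.N15.UnitLayerBgCol (unitBondMatC unitBondMatC_add unitBondMatC_sub unitBondMatC_zero cdist)
open Summit.QuantumFields.YangMills.BalabanUVNodes.N15.Gluing (cvM CvX CvX' cvNL cvNL' cvGlued cvGlued')

variable (d : ℕ) {L : ℕ} [NeZero L] (ι : Type) [Fintype ι] [DecidableEq ι] (a : ℝ)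

/-! ## §1 The middle factor for any propagator -/

/-- **THE SITE∕UNIT MIDDLE FACTOR FOR ANY COARSE PROPAGATOR `X`** with the averaging `Q⊗1 + D`, `Q*⊗1 + E`: `zAnyC X D E := unitBondMatC((Q⊗1 + D)∘X∘(Q*⊗1 + E) − (Q⊗1)∘(G⊗1)∘(Q*⊗1))`
— the (3.48)-shaped covariantly averaged sandwich of `X` minus its flat zero-field value, read at the coloured unit bonds.  The honest form IS the definition. [cite: Balaban1985BackgroundPropagators, Thm 3.2 (3.48) p.398, (3.78)–(3.81) p.406 (shape); Balaban1984PropagatorsI, (1.102)–(1.103) p.34] -/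
def zAnyC (hL : Odd L ∧ 1 < L) (m kk : ℕ) (X : (CvX d L m kk hL × ι → ℝ) →ₗ[ℝ] (CvX d L m kk hL × ι → ℝ))
    (D : (CvX d L m kk hL × ι → ℝ) →ₗ[ℝ] ((Tor (cvM d L m kk hL) × Fin (d + 1)) × ι → ℝ)) (E : ((Tor (cvM d L m kk hL) × Fin (d + 1)) × ι → ℝ) →ₗ[ℝ] (CvX d L m kk hL × ι → ℝ)) :
    Matrix (B4.Idx (pbox (cvM d L m kk hL)) (d + 1) × ι) (B4.Idx (pbox (cvM d L m kk hL)) (d + 1) × ι) ℝ :=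
  unitBondMatC (cvM d L m kk hL) ι
    ((tensorId ι (qvRe (cvM d L m kk hL) (L ^ kk)) + D) ∘ₗ X ∘ₗ (tensorId ι (qvAdjRe (cvM d L m kk hL) (L ^ kk)) + E) -
      tensorId ι (qvRe (cvM d L m kk hL) (L ^ kk)) ∘ₗ tensorId ι (gOp (cvM d L m kk hL) (L ^ kk) a) ∘ₗ tensorId ι (qvAdjRe (cvM d L m kk hL) (L ^ kk)))

/-- **THE SITE∕UNIT MIDDLE FACTOR FOR ANY FINE PROPAGATOR `X′`**: `zAnyF X′ D′ E′ := unitBondMatC((Q′⊗1 + D′)∘X′∘(Q′*⊗1 + E′) − (Q′⊗1)∘(G′⊗1)∘(Q′*⊗1))`, on the SAME coloured unit bonds.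
[cite: Balaban1985BackgroundPropagators, Thm 3.2 (3.48) p.398, (3.78)–(3.81) p.406 (shape); Balaban1984PropagatorsI, (1.102)–(1.103) p.34] -/
def zAnyF (hL : Odd L ∧ 1 < L) (m kk r : ℕ) (X' : (CvX' d L m kk r hL × ι → ℝ) →ₗ[ℝ] (CvX' d L m kk r hL × ι → ℝ))
    (D' : (CvX' d L m kk r hL × ι → ℝ) →ₗ[ℝ] ((Tor (cvM d L m kk hL) × Fin (d + 1)) × ι → ℝ)) (E' : ((Tor (cvM d L m kk hL) × Fin (d + 1)) × ι → ℝ) →ₗ[ℝ] (CvX' d L m kk r hL × ι → ℝ)) :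
    Matrix (B4.Idx (pbox (cvM d L m kk hL)) (d + 1) × ι) (B4.Idx (pbox (cvM d L m kk hL)) (d + 1) × ι) ℝ :=
  unitBondMatC (cvM d L m kk hL) ι
    ((tensorId ι (qvRe (cvM d L m kk hL) (L ^ r * L ^ kk)) + D') ∘ₗ X' ∘ₗ (tensorId ι (qvAdjRe (cvM d L m kk hL) (L ^ r * L ^ kk)) + E') -
      tensorId ι (qvRe (cvM d L m kk hL) (L ^ r * L ^ kk)) ∘ₗ tensorId ι (gOp (cvM d L m kk hL) (L ^ r * L ^ kk) a) ∘ₗ tensorId ι (qvAdjRe (cvM d L m kk hL) (L ^ r * L ^ kk)))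

/-- ★ **SPLITTING, COARSE**: `zAnyC X D E = unitBondMatC((Q⊗1)∘(X − G⊗1)∘(Q*⊗1)) + unitBondMatC(D∘X∘(Q*⊗1 + E)) + unitBondMatC((Q⊗1)∘X∘E)` — the increment sandwiched flatly plus the two
perturbation sandwiches of the FULL propagator ((Q-2a) `covSandwich_sub_eq`). [folklore] -/
theorem zAnyC_split (hL : Odd L ∧ 1 < L) (m kk : ℕ) (X : (CvX d L m kk hL × ι → ℝ) →ₗ[ℝ] (CvX d L m kk hL × ι → ℝ))
    (D : (CvX d L m kk hL × ι → ℝ) →ₗ[ℝ] ((Tor (cvM d L m kk hL) × Fin (d + 1)) × ι → ℝ)) (E : ((Tor (cvM d L m kk hL) × Fin (d + 1)) × ι → ℝ) →ₗ[ℝ] (CvX d L m kk hL × ι → ℝ)) :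
    zAnyC d ι a hL m kk X D E =
      unitBondMatC (cvM d L m kk hL) ι (tensorId ι (qvRe (cvM d L m kk hL) (L ^ kk)) ∘ₗ (X - tensorId ι (gOp (cvM d L m kk hL) (L ^ kk) a)) ∘ₗ tensorId ι (qvAdjRe (cvM d L m kk hL) (L ^ kk))) +
      unitBondMatC (cvM d L m kk hL) ι (D ∘ₗ X ∘ₗ (tensorId ι (qvAdjRe (cvM d L m kk hL) (L ^ kk)) + E)) +
      unitBondMatC (cvM d L m kk hL) ι (tensorId ι (qvRe (cvM d L m kk hL) (L ^ kk)) ∘ₗ X ∘ₗ E) := by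
  rw [zAnyC, covSandwich_sub_eq, unitBondMatC_add, unitBondMatC_add, add_assoc]

/-- ★ **SPLITTING, FINE**: `zAnyF X′ D′ E′ = unitBondMatC((Q′⊗1)∘(X′ − G′⊗1)∘(Q′*⊗1)) + unitBondMatC(D′∘X′∘(Q′*⊗1 + E′)) + unitBondMatC((Q′⊗1)∘X′∘E′)`. [folklore] -/
theorem zAnyF_split (hL : Odd L ∧ 1 < L) (m kk r : ℕ) (X' : (CvX' d L m kk r hL × ι → ℝ) →ₗ[ℝ] (CvX' d L m kk r hL × ι → ℝ))
    (D' : (CvX' d L m kk r hL × ι → ℝ) →ₗ[ℝ] ((Tor (cvM d L m kk hL) × Fin (d + 1)) × ι → ℝ)) (E' : ((Tor (cvM d L m kk hL) × Fin (d + 1)) × ι → ℝ) →ₗ[ℝ] (CvX' d L m kk r hL × ι → ℝ)) :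
    zAnyF d ι a hL m kk r X' D' E' =
      unitBondMatC (cvM d L m kk hL) ι (tensorId ι (qvRe (cvM d L m kk hL) (L ^ r * L ^ kk)) ∘ₗ (X' - tensorId ι (gOp (cvM d L m kk hL) (L ^ r * L ^ kk) a)) ∘ₗ
          tensorId ι (qvAdjRe (cvM d L m kk hL) (L ^ r * L ^ kk))) +
      unitBondMatC (cvM d L m kk hL) ι (D' ∘ₗ X' ∘ₗ (tensorId ι (qvAdjRe (cvM d L m kk hL) (L ^ r * L ^ kk)) + E')) +
      unitBondMatC (cvM d L m kk hL) ι (tensorId ι (qvRe (cvM d L m kk hL) (L ^ r * L ^ kk)) ∘ₗ X' ∘ₗ E') := by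
  rw [zAnyF, covSandwich_sub_eq, unitBondMatC_add, unitBondMatC_add, add_assoc]

/-- At the zero-field propagator `X = G⊗1` with the flat averaging (`D = E = 0`) the middle factor VANISHES. [bookkeeping] -/
theorem zAnyC_tensorId_gOp (hL : Odd L ∧ 1 < L) (m kk : ℕ) :
    zAnyC d ι a hL m kk (tensorId ι (gOp (cvM d L m kk hL) (L ^ kk) a)) 0 0 = 0 := by
  rw [zAnyC, add_zero, add_zero, sub_self, unitBondMatC_zero]

/-- Fine twin: `zAnyF (G′⊗1) 0 0 = 0`. [bookkeeping] -/
theorem zAnyF_tensorId_gOp (hL : Odd L ∧ 1 < L) (m kk r : ℕ) :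
    zAnyF d ι a hL m kk r (tensorId ι (gOp (cvM d L m kk hL) (L ^ r * L ^ kk) a)) 0 0 = 0 := by
  rw [zAnyF, add_zero, add_zero, sub_self, unitBondMatC_zero]

section Dictionary

variable (mm : Type) [Fintype mm] [DecidableEq mm] (e : Matrix mm mm ℂ ≃L[ℝ] (ι → ℝ))

set_option maxRecDepth 8192 in
/-- ★ **DICTIONARY WITH (Q-2a), COARSE**: at dag-n15-c's FILE 133 propagator (covariant averaging summand FLAT: `P := cvNL`, `NV := 0`) the generic middle factor IS (Q-2a)'s `zCovC`:
`zCovC A′ D E = zAnyC (cvGlued … (e^{ηĀ′}) (cvNL) 0) D E` ((Q-2a) `zCovC_eq`). [bookkeeping] -/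
theorem zCovC_eq_zAnyC (hL : Odd L ∧ 1 < L) (m kk r : ℕ) (A' : Fin (d + 1) → CvX' d L m kk r hL → Matrix mm mm ℂ)
    (D : (CvX d L m kk hL × ι → ℝ) →ₗ[ℝ] ((Tor (cvM d L m kk hL) × Fin (d + 1)) × ι → ℝ)) (E : ((Tor (cvM d L m kk hL) × Fin (d + 1)) × ι → ℝ) →ₗ[ℝ] (CvX d L m kk hL × ι → ℝ)) :
    zCovC d mm ι a e hL m kk r A' D E =
      zAnyC d ι a hL m kk
        (cvGlued d L m kk hL a ((((L ^ kk : ℕ) : ℝ))⁻¹) ι e (fun _ _ => (1 : Matrix mm mm ℂ))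
          (fun μ x => NormedSpace.exp (((((L ^ kk : ℕ) : ℝ))⁻¹) • gavgM (Matrix mm mm ℂ) (Fin (d + 1)) (kingPrV L kk r (cvM d L m kk hL)) A' μ x)) (cvNL d L m kk hL a ι) (fun _ => 0))
        D E := by
  rw [zCovC_eq, zAnyC]

set_option maxRecDepth 8192 in
/-- ★ **DICTIONARY WITH (Q-2a), FINE**: `zCovF A′ D′ E′ = zAnyF (cvGlued′ … (e^{η′A′}) (cvNL′) 0) D′ E′` ((Q-2a) `zCovF_eq`). [bookkeeping] -/
theorem zCovF_eq_zAnyF (hL : Odd L ∧ 1 < L) (m kk r : ℕ) (A' : Fin (d + 1) → CvX' d L m kk r hL → Matrix mm mm ℂ)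
    (D' : (CvX' d L m kk r hL × ι → ℝ) →ₗ[ℝ] ((Tor (cvM d L m kk hL) × Fin (d + 1)) × ι → ℝ)) (E' : ((Tor (cvM d L m kk hL) × Fin (d + 1)) × ι → ℝ) →ₗ[ℝ] (CvX' d L m kk r hL × ι → ℝ)) :
    zCovF d mm ι a e hL m kk r A' D' E' =
      zAnyF d ι a hL m kk r
        (cvGlued' d L m kk r hL a ((((L ^ r * L ^ kk : ℕ) : ℝ))⁻¹) ι e (fun _ _ => (1 : Matrix mm mm ℂ)) (fun μ x' => NormedSpace.exp (((((L ^ r * L ^ kk : ℕ) : ℝ))⁻¹) • A' μ x'))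
          (cvNL' d L m kk r hL a ι) (fun _ => 0))
        D' E' := by
  rw [zCovF_eq, zAnyF]

end Dictionary

/-! ## §2 The increment identity of a right inverse -/

section Increment

variable {V : Type} [AddCommGroup V] [Module ℝ V]

omit [NeZero L] [Fintype ι] [DecidableEq ι] in
/-- ★ **THE INCREMENT IDENTITY**: if `X` is a RIGHT inverse of `T₀ − P` (`X∘(T₀ − P) = 1`) and `G` a right inverse of `T₀` (`T₀∘G = 1`), then `X − G = X∘P∘G` — (I) §4 with the perturbation
`P` abstract (there `P = speciesOpM(U)`: the covariant Laplacian's departure from the flat one; at dag-n15-c's `X_q` also the covariant averaging summand `N_V^Q(U)`). [folklore] -/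
theorem sub_eq_comp_comp_of_comp_sub_eq_id (X T₀ P G : V →ₗ[ℝ] V) (hX : X ∘ₗ (T₀ - P) = LinearMap.id) (hG : T₀ ∘ₗ G = LinearMap.id) :
    X - G = X ∘ₗ P ∘ₗ G := by
  have h1 : X ∘ₗ T₀ ∘ₗ G = X := by rw [hG, LinearMap.comp_id]
  have h2 : (X ∘ₗ (T₀ - P)) ∘ₗ G = G := by rw [hX, LinearMap.id_comp]
  have h3 : (X ∘ₗ (T₀ - P)) ∘ₗ G = X ∘ₗ T₀ ∘ₗ G - X ∘ₗ P ∘ₗ G := by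
    rw [LinearMap.comp_sub, LinearMap.sub_comp, LinearMap.comp_assoc, LinearMap.comp_assoc]
  rw [h3, h1] at h2
  -- `X − X∘P∘G = G`
  calc X - G = X - (X - X ∘ₗ P ∘ₗ G) := by rw [h2]
    _ = X ∘ₗ P ∘ₗ G := sub_sub_cancel _ _

omit [NeZero L] [Fintype ι] [DecidableEq ι] in
/-- The same with the perturbed operator written as a SUM `T₀ + P′` (`P := −P′`): `X∘(T₀ + P′) = 1`, `T₀∘G = 1` ⟹ `X − G = −(X∘P′∘G)`. [folklore] -/
theorem sub_eq_neg_comp_comp_of_comp_add_eq_id (X T₀ P' G : V →ₗ[ℝ] V) (hX : X ∘ₗ (T₀ + P') = LinearMap.id) (hG : T₀ ∘ₗ G = LinearMap.id) :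
    X - G = -(X ∘ₗ P' ∘ₗ G) := by
  have h := sub_eq_comp_comp_of_comp_sub_eq_id X T₀ (-P') G (by rwa [sub_neg_eq_add]) hG
  rw [h, LinearMap.neg_comp, LinearMap.comp_neg]

end Increment

/-! ## §3 Three scalar budgets for (𝟙P-b) (kept out of the operator context) -/

section Budgets

/-- Letter (i)∕(ii) budget: `c·(e₀·ζ·e₀ + ρ_D·B·(e₀ + ρ_E) + e₀·B·ρ_E) ≤ K·(ζ + ρ_D + ρ_E)` once `K ≥ c·(e₀² + B·(e₀ + 1) + e₀·B)` (`0 ≤ ρ_E ≤ 1`). [folklore] -/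
theorem amp_any_size_le {c e₀ ζ ρD ρE B K : ℝ} (hc : 0 ≤ c) (he₀ : 0 ≤ e₀) (hζ : 0 ≤ ζ) (hρD : 0 ≤ ρD) (hρE : 0 ≤ ρE) (hρE1 : ρE ≤ 1) (hB : 0 ≤ B)
    (hK : c * (e₀ * e₀ + B * (e₀ + 1) + e₀ * B) ≤ K) :
    1 * e₀ * ζ * (1 * e₀) * c + ρD * B * (1 * e₀ + ρE) * c + 1 * e₀ * B * ρE * c ≤ K * (ζ + ρD + ρE) := by
  set V : ℝ := e₀ * e₀ + B * (e₀ + 1) + e₀ * B with hV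
  have hs : 0 ≤ ζ + ρD + ρE := by positivity
  have n1 : 0 ≤ e₀ * e₀ := mul_nonneg he₀ he₀
  have n2 : 0 ≤ B * (e₀ + 1) := by positivity
  have n3 : 0 ≤ e₀ * B := mul_nonneg he₀ hB
  have v1 : e₀ * e₀ ≤ V := by rw [hV]; linarith
  have v2 : B * (e₀ + 1) ≤ V := by rw [hV]; linarith
  have v3 : e₀ * B ≤ V := by rw [hV]; linarith
  have hV0 : 0 ≤ V := n1.trans v1
  have hq : 1 * e₀ + ρE ≤ e₀ + 1 := by linarith
  have q1 : e₀ * e₀ * ζ ≤ V * ζ := mul_le_mul_of_nonneg_right v1 hζ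
  have q2 : ρD * (B * (1 * e₀ + ρE)) ≤ ρD * V := mul_le_mul_of_nonneg_left ((mul_le_mul_of_nonneg_left hq hB).trans v2) hρD
  have q3 : e₀ * B * ρE ≤ V * ρE := mul_le_mul_of_nonneg_right v3 hρE
  have hsum : e₀ * e₀ * ζ + ρD * (B * (1 * e₀ + ρE)) + e₀ * B * ρE ≤ V * (ζ + ρD + ρE) := by linarith
  have hK' : c * V ≤ K := by rw [hV]; exact hK
  calc _ = c * (e₀ * e₀ * ζ + ρD * (B * (1 * e₀ + ρE)) + e₀ * B * ρE) := by ring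
    _ ≤ c * (V * (ζ + ρD + ρE)) := mul_le_mul_of_nonneg_left hsum hc
    _ = (c * V) * (ζ + ρD + ρE) := by ring
    _ ≤ K * (ζ + ρD + ρE) := mul_le_mul_of_nonneg_right hK' hs

/-- The additive unit of the letter-(iii) budget: every coefficient of `amp_any_defect_le` is one of its (nonnegative) summands. [folklore] -/
def ampUnit (e₀ B m : ℝ) : ℝ := e₀ * e₀ + B * e₀ + B + (e₀ + 1) + (e₀ + 1) * m + B * (e₀ + 1) + e₀ + e₀ * m

/-- `0 ≤ ampUnit e₀ B m` for nonnegative letters. [folklore] -/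
theorem ampUnit_nonneg {e₀ B m : ℝ} (he₀ : 0 ≤ e₀) (hB : 0 ≤ B) (hm : 0 ≤ m) : 0 ≤ ampUnit e₀ B m := by
  unfold ampUnit; positivity

/-- Letter (iii) budget: the nine defect amplitudes of the three sandwich differences against `K·(θ + (ζ + ρ_D + ρ_E)·t + τ_D + τ_E)`, where `η ≤ t`, `θ_G ≤ m·t` (the flat pair's own two-grid defect),
`0 ≤ ρ_D, ρ_E ≤ 1`, and `K ≥ 4·c·ampUnit e₀ B m`. [folklore] -/
theorem amp_any_defect_le {c e₀ ζ θ θG m t η ρD ρE τD τE B K : ℝ} (hc : 0 ≤ c) (he₀ : 0 ≤ e₀) (hζ : 0 ≤ ζ) (hθ : 0 ≤ θ) (hθG : 0 ≤ θG) (hm : 0 ≤ m)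
    (hθGm : θG ≤ m * t) (ht : 0 ≤ t) (hη : 0 ≤ η) (hηt : η ≤ t) (hρD : 0 ≤ ρD) (hρD1 : ρD ≤ 1) (hρE : 0 ≤ ρE) (hρE1 : ρE ≤ 1) (hτD : 0 ≤ τD) (hτE : 0 ≤ τE) (hB : 0 ≤ B)
    (hK : 4 * c * ampUnit e₀ B m ≤ K) :
    c * (1 * e₀ * ζ * (2 * e₀ * η) + 1 * e₀ * (1 * e₀) * θ + ζ * (1 * e₀) * (2 * e₀ * η)) +
      c * (ρD * B * (2 * e₀ * η + τE) + ρD * (1 * e₀ + ρE) * (θ + θG) + B * (1 * e₀ + ρE) * τD) +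
      c * (1 * e₀ * B * τE + 1 * e₀ * ρE * (θ + θG) + B * ρE * (2 * e₀ * η)) ≤ K * (θ + (ζ + ρD + ρE) * t + τD + τE) := by
  set U : ℝ := ampUnit e₀ B m with hU
  have hU0 : 0 ≤ U := ampUnit_nonneg he₀ hB hm
  have hS : 0 ≤ θ + (ζ + ρD + ρE) * t + τD + τE := by positivity
  -- every coefficient is a summand of `U`
  have n1 : 0 ≤ e₀ * e₀ := mul_nonneg he₀ he₀
  have n2 : 0 ≤ B * e₀ := mul_nonneg hB he₀
  have n4 : 0 ≤ (e₀ + 1) * m := by positivity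
  have n5 : 0 ≤ B * (e₀ + 1) := by positivity
  have n6 : 0 ≤ e₀ * m := mul_nonneg he₀ hm
  have u1 : e₀ * e₀ ≤ U := by rw [hU, ampUnit]; linarith
  have u2 : B * e₀ ≤ U := by rw [hU, ampUnit]; linarith
  have u3 : B ≤ U := by rw [hU, ampUnit]; linarith
  have u4 : e₀ + 1 ≤ U := by rw [hU, ampUnit]; linarith
  have u5 : (e₀ + 1) * m ≤ U := by rw [hU, ampUnit]; linarith
  have u6 : B * (e₀ + 1) ≤ U := by rw [hU, ampUnit]; linarith
  have u7 : e₀ ≤ U := by rw [hU, ampUnit]; linarith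
  have u8 : e₀ * m ≤ U := by rw [hU, ampUnit]; linarith
  have hq : 1 * e₀ + ρE ≤ e₀ + 1 := by linarith
  have hq0 : 0 ≤ 1 * e₀ + ρE := by positivity
  -- the monomial inequalities
  have p1 : e₀ * e₀ * (ζ * η) ≤ U * (ζ * t) := mul_le_mul u1 (mul_le_mul_of_nonneg_left hηt hζ) (by positivity) hU0
  have p2 : e₀ * e₀ * θ ≤ U * θ := mul_le_mul_of_nonneg_right u1 hθ
  have p3 : B * e₀ * η ≤ U * t := mul_le_mul u2 hηt hη hU0
  have p3D : ρD * (B * e₀ * η) ≤ ρD * (U * t) := mul_le_mul_of_nonneg_left p3 hρD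
  have p3E : ρE * (B * e₀ * η) ≤ ρE * (U * t) := mul_le_mul_of_nonneg_left p3 hρE
  have p4 : ρD * (B * τE) ≤ 1 * (U * τE) := mul_le_mul hρD1 (mul_le_mul_of_nonneg_right u3 hτE) (by positivity) zero_le_one
  have p5 : ρD * ((1 * e₀ + ρE) * θ) ≤ 1 * (U * θ) :=
    mul_le_mul hρD1 (mul_le_mul_of_nonneg_right (hq.trans u4) hθ) (by positivity) zero_le_one
  have p6a : (1 * e₀ + ρE) * θG ≤ U * t :=
    calc (1 * e₀ + ρE) * θG ≤ (e₀ + 1) * (m * t) := mul_le_mul hq hθGm hθG (by positivity)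
      _ = ((e₀ + 1) * m) * t := by ring
      _ ≤ U * t := mul_le_mul_of_nonneg_right u5 ht
  have p6 : ρD * ((1 * e₀ + ρE) * θG) ≤ ρD * (U * t) := mul_le_mul_of_nonneg_left p6a hρD
  have p7 : B * (1 * e₀ + ρE) * τD ≤ U * τD := mul_le_mul_of_nonneg_right ((mul_le_mul_of_nonneg_left hq hB).trans u6) hτD
  have p8 : B * e₀ * τE ≤ U * τE := mul_le_mul_of_nonneg_right u2 hτE
  have p9 : ρE * (e₀ * θ) ≤ 1 * (U * θ) := mul_le_mul hρE1 (mul_le_mul_of_nonneg_right u7 hθ) (by positivity) zero_le_one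
  have p10a : e₀ * θG ≤ U * t :=
    calc e₀ * θG ≤ e₀ * (m * t) := mul_le_mul_of_nonneg_left hθGm he₀
      _ = (e₀ * m) * t := by ring
      _ ≤ U * t := mul_le_mul_of_nonneg_right u8 ht
  have p10 : ρE * (e₀ * θG) ≤ ρE * (U * t) := mul_le_mul_of_nonneg_left p10a hρE
  -- the sum is `≤ 4U·(…)`
  have hsum : (1 * e₀ * ζ * (2 * e₀ * η) + 1 * e₀ * (1 * e₀) * θ + ζ * (1 * e₀) * (2 * e₀ * η)) +
      (ρD * B * (2 * e₀ * η + τE) + ρD * (1 * e₀ + ρE) * (θ + θG) + B * (1 * e₀ + ρE) * τD) +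
      (1 * e₀ * B * τE + 1 * e₀ * ρE * (θ + θG) + B * ρE * (2 * e₀ * η)) ≤ 4 * U * (θ + (ζ + ρD + ρE) * t + τD + τE) := by
    have s0 : 0 ≤ U * θ := mul_nonneg hU0 hθ
    have s1 : 0 ≤ U * (ρD * t) := mul_nonneg hU0 (mul_nonneg hρD ht)
    have s2 : 0 ≤ U * (ρE * t) := mul_nonneg hU0 (mul_nonneg hρE ht)
    have s3 : 0 ≤ U * τD := mul_nonneg hU0 hτD
    have s4 : 0 ≤ U * τE := mul_nonneg hU0 hτE
    linarith
  have hK' : c * (4 * U) ≤ K := by rw [hU]; linarith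
  calc _ = c * ((1 * e₀ * ζ * (2 * e₀ * η) + 1 * e₀ * (1 * e₀) * θ + ζ * (1 * e₀) * (2 * e₀ * η)) +
        (ρD * B * (2 * e₀ * η + τE) + ρD * (1 * e₀ + ρE) * (θ + θG) + B * (1 * e₀ + ρE) * τD) +
        (1 * e₀ * B * τE + 1 * e₀ * ρE * (θ + θG) + B * ρE * (2 * e₀ * η))) := by ring
    _ ≤ c * (4 * U * (θ + (ζ + ρD + ρE) * t + τD + τE)) := mul_le_mul_of_nonneg_left hsum hc
    _ = (c * (4 * U)) * (θ + (ζ + ρD + ρE) * t + τD + τE) := by ring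
    _ ≤ K * (θ + (ζ + ρD + ρE) * t + τD + τE) := mul_le_mul_of_nonneg_right hK' hS

/-- The flat pair's rate: `x⁻¹ ≤ x^{−1∕16}` for `x ≥ 1` (`η = (L^k)⁻¹`, `t = (L^k)^{−1∕16}`). [folklore] -/
theorem inv_le_rpow_neg_sixteenth {x : ℝ} (hx : 1 ≤ x) : x⁻¹ ≤ x ^ (-(1 / 16 : ℝ)) := by
  rw [← Real.rpow_neg_one]; exact Real.rpow_le_rpow_of_exponent_le hx (by norm_num)

end Budgets

end Summit.QuantumFields.YangMills.BalabanUVNodes.N15.GluedZeroField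

end
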